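/-
Copyright (c) 2026 the pub-hodgecm-mathlib formalisation cell (harness21).  Prover seat hodgecm-mathlib-LH4-p16 (g2), req620 Track A «(D-RAM) FOUR-FRAME» squad
(STAGE-1b, row (2) of the piece `f_{T₊}`, the (β₂) road (R-36); β₂ sub-dealer LH4-p04 «= ROAD K5∕K6»; LH4-p19 (g2)'s COUNT SOCKETS ★ p863807 ∕ ★ p863833 — the (hLit)
hypothesis DISCHARGED in the socket's binder shape; CELLREAD-C.sig.v2 item (a)), 2026-09-05.
-/
import Summits.HodgeConjecture.HodgeConjecture.Theorems.F0P3cDyRamRowCellSocketReads      -- ★ p863914 (this seat): frame conventions; brings ★ p863859 (`fixedNorm_mul`), ★ p862871 (`exists_doublyFixed_coord`), ★ p863477 (`trace_letters`)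
import Summits.HodgeConjecture.HodgeConjecture.Theorems.F0P3cDyRamRowCellDigitClass       -- ★ p863710 (this seat): `normRho_digit_eq`, `normRho_u₀_eq`, `exists_fixed_normTheta_normRho_div_of_near`
import HarnessLib

/-!
# Crux `H413`, line LH4 «(D-RAM) FOUR-FRAME» — STAGE-1b, row (2), the (β₂) road (R-36), (ROW-INT) ∕ ‹CORE›: «THE LITERAL READ OF A ROW-CELL DIGIT» — LH4-p19 (g2)'s COUNT-SOCKET
# hypothesis (hLit) («every digit within `r` of a vertex coordinate is a LITERAL digit») in the socket's `∀ Λ x₀ V₀, GEN Λ x₀ → … → |Vf x₀ − jE V₀| ≤ r → LIT V₀` shape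

Cell `hodgecm-mathlib` (D-0151), FLOOR 0, crux item H413 = `stmt-HodgeConjecture-24833`, route of record `HCCMUnconditional`; squad F0∕P3c∕LH4; lane
`--supports stmt-HodgeConjecture-24833 --as helper` (count-neutral; pays NO tier-0 row).  THEOREMS ONLY (no `def`, no instance, no notation, no `sorry`, default heartbeats);
★-only imports; states NO law; (β₂) stays a HYPOTHESIS.
WHAT.  With the instantiations of ★ p863914 (`Vf x₀ = (κ̂(x₀) − κ₀) ∕ ξ₀`, `κ̂ = ρu₀ ∕ t`, `u₀ = h·x₀Θx₀`, `t = Tr_ρ u₀`) the LITERAL predicate of a digit is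
**`LIT V₀ :≡ |κ₀ + jE V₀·ξ₀|·|cc(α − ρα)| = |ϖE|^b ∧ Q(κ₀ + jE V₀·ξ₀) ∕ N_ρ(h) ∈ 𝒩`** (ON THE CELL'S SPHERE and in the literal's `Q`-class; `Q = N_ρ`, `𝒩 = {eΘe : ρe = e}`; the
sphere clause is what makes the socket's (hF) payable by ★ p863524 — digits of the unit `V`-ball off the sphere `|κ| = R` belong to OTHER cells and have empty fibres) —
REFERENCE-FREE: §1 `Q(κ̂(x₀)) ∕ N_ρ(h) = N_Θ(x₀ρx₀ ∕ t) ∈ 𝒩` for EVERY vertex of the literal (★ p863710 `normRho_u₀_eq`); so (§2, HEAD) for a vertex `(Λ, x₀)` with the four `GEN`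
clauses and a fixed digit `V₀` with `|Vf x₀ − jE V₀| ≤ r`, `r·|ξ₀| < R` (`R = |ϖE|^b ∕ |cc(α − ρα)|` the cell's radius) and the class letter `hdeep` at depth `r₀` (`r·|ξ₀| ≤ r₀·R`):
`LIT V₀` (strict ultrametric step for the sphere clause; ★ p863710 local constancy `exists_fixed_normTheta_normRho_div_of_near` × §1 × closure of `𝒩` under products for the class).
WHAT IS NOT CLAIMED: (hI), (hF), (hbase), any count; the digit system `Rd` must consist of `σ`-fixed elements (true for the representative systems of ★ LH4-p14).
HONEST LABEL.  Count-neutral; nothing printed is asserted; no census law is stated; `HC_CM` is proved only modulo the 7 printed citations (2 remaining named inputs: hLiu418 =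
`stmt-HodgeConjecture-24832`, h413 = `stmt-HodgeConjecture-24833`) until rung 0 closes.
## References
* [Kottwitz1986BaseChangeUnits] R. E. Kottwitz, *Base change for unit elements of Hecke algebras*, Compositio Math. 60 (1986): §1 pp. 240–241.
* [Serre1979] J.-P. Serre, *Local Fields*, GTM 67 (1979): Ch. III §6 Prop. 12; Ch. V §3; Ch. XIV §6.
* [Jacobowitz1962] R. Jacobowitz, *Hermitian forms over local fields*, Amer. J. Math. 84 (1962): §4.
-/

set_option autoImplicit false

noncomputable section

namespace Summit.HodgeConjecture.HodgeConjecture.Cruxes.H413.F0P3cDyRamRowCellSocketLit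

open scoped Valued WithZero
open WithZero
open Literature.NumberTheory.Automorphic.UnitaryThreeFourFrame (IsRamifiedQuadraticDatum)
open Summit.HodgeConjecture.HodgeConjecture.Cruxes.H413.F0P3cDyRamToricCensusDefs
open Summit.HodgeConjecture.HodgeConjecture.Cruxes.H413.F0P3cDyRamRowVertexPopulationRead (fixedNorm_mul)
open Summit.HodgeConjecture.HodgeConjecture.Cruxes.H413.F0P3cDyRamRowVertexAffineCoordinate (exists_doublyFixed_coord)
open Summit.HodgeConjecture.HodgeConjecture.Cruxes.H413.F0P3cDyRamRowCellDigitClass (normRho_digit_eq normRho_u₀_eq exists_fixed_normTheta_normRho_div_of_near)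

variable {E M : Type} [Field E] [Valued E ℤᵐ⁰] [Field M] [Valued M ℤᵐ⁰] {ρ Θ : M →+* M} {α : M}

/-! ## §1 The digit of every vertex is a literal digit (reference-free form of ★ p863710 §2) -/
omit [Valued M ℤᵐ⁰] in
/-- **`Q(κ̂) ∕ N_ρ(h) = N_Θ(x₀ρx₀ ∕ t) ∈ 𝒩`** for `κ̂ = ρu₀ ∕ t`, `u₀ = h·x₀Θx₀`, any doubly-fixed `t` (at the vertex: `t = Tr_ρ u₀`); `h ≠ 0`, `ρ² = 1`, `Θρ = ρΘ`.  (The `Q`-class of a literal's digits is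
the class of `N_ρ(h)` — ★ p863710's «one `Q`-class per literal», now without a reference vertex.) [cite: Serre1979, Ch. XIV §6] [cite: Kottwitz1986BaseChangeUnits, §1 pp. 240–241] -/
theorem exists_fixed_normTheta_normRho_digit_div_normRho (hρρ : ∀ x, ρ (ρ x) = x) (hΘρ : ∀ x, Θ (ρ x) = ρ (Θ x)) {hM t : M} (hh : hM ≠ 0)
    (hρt : ρ t = t) (hΘt : Θ t = t) (x₀ : M) :
    ∃ e : M, ρ e = e ∧ e * Θ e = ρ (hM * (x₀ * Θ x₀)) / t * ρ (ρ (hM * (x₀ * Θ x₀)) / t) / (hM * ρ hM) := by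
  have hρh0 : ρ hM ≠ 0 := (map_ne_zero ρ).2 hh
  refine ⟨x₀ * ρ x₀ / t, by rw [map_div₀, map_mul, hρρ, hρt, mul_comm (ρ x₀) x₀], ?_⟩
  have hQ : ρ (hM * (x₀ * Θ x₀)) / t * ρ (ρ (hM * (x₀ * Θ x₀)) / t) = (hM * ρ hM) * ((x₀ * ρ x₀) * Θ (x₀ * ρ x₀)) / (t * t) := by
    rw [map_div₀, hρρ, hρt, div_mul_div_comm, mul_comm (ρ (hM * (x₀ * Θ x₀))), normRho_u₀_eq hΘρ hM x₀]
  rw [hQ, map_div₀ Θ, hΘt, mul_div_assoc (hM * ρ hM) ((x₀ * ρ x₀) * Θ (x₀ * ρ x₀)) (t * t),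
    mul_div_cancel_left₀ _ (mul_ne_zero hh hρh0), div_mul_div_comm]

/-! ## §2 HEAD — (hLit) in socket shape -/
/-- **(hLit) «EVERY DIGIT WITHIN `r` OF A VERTEX COORDINATE IS A LITERAL DIGIT», SOCKET SHAPE.**  One-field letters (`jE`-letters; `ρ, Θ` commuting involutions, `ρ` isometric;
`Θh = h ≠ 0`); the cell `(j, b)` (`1 ≤ b`, letter `hFgap`); the reference pair `(κ₀, ξ₀)` (`Tr_ρ κ₀ = 1`, `Θκ₀ = κ₀`, `ρξ₀ = −ξ₀`, `Θξ₀ = ξ₀ ≠ 0`); precisions `r, r₀` with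
`r·|ξ₀|·|cc(α − ρα)| < |ϖE|^b` (`r·|ξ₀| <` the cell radius `R`) and `r·|ξ₀|·|cc(α − ρα)| ≤ r₀·|ϖE|^b`; the class letter `hdeep` at depth `r₀` (doubly-fixed `u ≡ 1 (r₀)` lie in
`𝒩`).  THEN for every `(Λ, x₀)` with the four `GEN` clauses and every `σ`-fixed `V₀ : E` with `|Vf x₀ − jE V₀| ≤ r`:
`|κ₀ + jE V₀·ξ₀|·|cc(α − ρα)| = |ϖE|^b ∧ ∃ e, ρe = e ∧ eΘe = (κ₀ + jE V₀·ξ₀)·ρ(κ₀ + jE V₀·ξ₀) ∕ (h·ρh)` — the socket's `LIT V₀` with `LIT :≡ (sphere) ∧ Q(κ₀ + jE(·)ξ₀) ∕ N_ρ(h) ∈ 𝒩`.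
[cite: Kottwitz1986BaseChangeUnits, §1 pp. 240–241] [cite: Serre1979, Ch. III §6 Prop. 12; Ch. V §3; Ch. XIV §6] [cite: Jacobowitz1962, §4] -/
theorem lit_of_near_of_gen {σ : E →+* E} {ϖ : E} {d tE : ℕ} (hD : IsRamifiedQuadraticDatum σ ϖ d tE)
    (jE : E →+* M) (hjv : ∀ c, Valued.v (jE c) ≤ 1 ↔ Valued.v c ≤ 1) (hjfix : ∀ z, ρ z = z ↔ ∃ c, jE c = z) (hΘj : ∀ c, Θ (jE c) = jE (σ c))
    (hρρ : ∀ x, ρ (ρ x) = x) (hvρ : ∀ x, Valued.v (ρ x) = Valued.v x) (hΘΘ : ∀ x, Θ (Θ x) = x) (hΘρ : ∀ x, Θ (ρ x) = ρ (Θ x))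
    {hM : M} (hΘh : Θ hM = hM) (hh : hM ≠ 0) {j b : ℕ} (hb1 : 1 ≤ b) (hcc : jE ϖ ^ j * (α - ρ α) ≠ 0)
    (hFgap : ∀ z : M, ρ z = z → Θ z = z → Valued.v (jE ϖ) < Valued.v z → Valued.v z ≤ 1 → Valued.v z = 1)
    {κ₀ ξ₀ : M} (hκ₀ : κ₀ + ρ κ₀ = 1) (hΘκ₀ : Θ κ₀ = κ₀) (hξ : ρ ξ₀ = -ξ₀) (hΘξ : Θ ξ₀ = ξ₀) (hξ0 : ξ₀ ≠ 0)
    {r r₀ : ℤᵐ⁰} (hrR : r * Valued.v ξ₀ * Valued.v (jE ϖ ^ j * (α - ρ α)) < Valued.v (jE ϖ) ^ b)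
    (hr₀ : r * Valued.v ξ₀ * Valued.v (jE ϖ ^ j * (α - ρ α)) ≤ r₀ * Valued.v (jE ϖ) ^ b)
    (hdeep : ∀ u : M, ρ u = u → Θ u = u → Valued.v (u - 1) ≤ r₀ → ∃ c : M, ρ c = c ∧ c * Θ c = u)
    (Λ : AddSubgroup M) (x₀ : M)
    (hG : x₀ ≠ 0 ∧ (∀ x, x ∈ Λ ↔ ∃ ζ, IsOrd ρ α (jE ϖ ^ j) ζ ∧ x = x₀ * ζ) ∧
      IsOrd ρ α (jE ϖ ^ j) (dualGen ρ Θ α (jE ϖ ^ j) hM x₀) ∧ ¬ IsOrd ρ α (jE ϖ ^ j) (dualGen ρ Θ α (jE ϖ ^ j) hM x₀ / jE ϖ) ∧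
      Valued.v (dualGen ρ Θ α (jE ϖ ^ j) hM x₀) = Valued.v (jE ϖ) ^ b)
    (V₀ : E) (hσV₀ : σ V₀ = V₀)
    (hnear : Valued.v ((ρ (hM * (x₀ * Θ x₀)) / (hM * (x₀ * Θ x₀) + ρ (hM * (x₀ * Θ x₀))) - κ₀) / ξ₀ - jE V₀) ≤ r) :
    Valued.v (κ₀ + jE V₀ * ξ₀) * Valued.v (jE ϖ ^ j * (α - ρ α)) = Valued.v (jE ϖ) ^ b ∧
      ∃ e : M, ρ e = e ∧ e * Θ e = (κ₀ + jE V₀ * ξ₀) * ρ (κ₀ + jE V₀ * ξ₀) / (hM * ρ hM) := by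
  obtain ⟨-, -, hϖ, -⟩ := id hD
  have hvϖ0 : Valued.v ϖ ≠ 0 := by rw [hϖ]; exact exp_ne_zero
  have hϖ0 : ϖ ≠ 0 := fun h0 => by rw [h0, map_zero] at hvϖ0; exact hvϖ0 rfl
  have hϖ1 : Valued.v ϖ ≤ 1 := by rw [hϖ, ← exp_zero, exp_le_exp]; norm_num
  have hjϖ0 : jE ϖ ≠ 0 := (map_ne_zero jE).2 hϖ0
  have hjϖ1 : Valued.v (jE ϖ) ≤ 1 := (hjv ϖ).2 hϖ1
  have hρj : ∀ c' : E, ρ (jE c') = jE c' := fun c' => (hjfix _).2 ⟨c', rfl⟩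
  obtain ⟨hx₀, -, hyO, hyprim, hylev⟩ := hG
  obtain ⟨hρt, hΘt, ht1⟩ := F0P3cDyRamRowCellFibreTransport.trace_letters (α := α) hρρ hΘΘ hΘρ hΘh (hρj ϖ) hjϖ0 hjϖ1 hb1 hcc hFgap hyO hyprim hylev
  -- §1: the vertex's own digit is a literal digit (obtained before the `set`s so that it folds)
  obtain ⟨e₂, hρe₂, he₂⟩ := exists_fixed_normTheta_normRho_digit_div_normRho (Θ := Θ) hρρ hΘρ hh hρt hΘt x₀
  set u₀ : M := hM * (x₀ * Θ x₀) with hu₀def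
  set t : M := u₀ + ρ u₀ with htdef
  have ht0 : t ≠ 0 := fun h0 => by rw [h0, map_zero] at ht1; exact zero_ne_one ht1
  have hΘu : Θ u₀ = u₀ := by rw [hu₀def, map_mul, map_mul, hΘh, hΘΘ]; ring
  -- the vertex's digit `κ̂ = ρu₀ ∕ t` on the line, its coordinate `V`
  have hκ : ρ u₀ / t + ρ (ρ u₀ / t) = 1 := by
    rw [map_div₀, hρρ, hρt, ← add_div, htdef, add_comm (ρ u₀) u₀, div_self ht0]
  have hΘκ : Θ (ρ u₀ / t) = ρ u₀ / t := by rw [map_div₀, hΘρ, hΘu, hΘt]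
  obtain ⟨V, hσV, hV⟩ := exists_doublyFixed_coord jE hjfix hΘj hκ hκ₀ hξ hξ0 hΘκ hΘκ₀ hΘξ
  have hjV : jE V = (ρ u₀ / t - κ₀) / ξ₀ := by rw [hV, add_sub_cancel_left, mul_div_cancel_right₀ _ hξ0]
  rw [← hjV] at hnear
  -- sizes: `R = |κ̂| = |u₀|`, `|u₀|·|cc(α − ρα)| = |ϖE|^b`
  have hY : dualGen ρ Θ α (jE ϖ ^ j) hM x₀ = u₀ * (jE ϖ ^ j * (α - ρ α)) := by rw [dualGen_def]
  have hu₀v : Valued.v u₀ * Valued.v (jE ϖ ^ j * (α - ρ α)) = Valued.v (jE ϖ) ^ b := by rw [← Valuation.map_mul, ← hY, hylev]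
  have hccpos : 0 < Valued.v (jE ϖ ^ j * (α - ρ α)) := zero_lt_iff.2 ((Valuation.ne_zero_iff _).2 hcc)
  have hκv : Valued.v (ρ u₀ / t) = Valued.v u₀ := by rw [map_div₀, ht1, div_one, hvρ]
  have hu₀0 : Valued.v u₀ ≠ 0 :=
    (Valuation.ne_zero_iff _).2 (mul_ne_zero hh (mul_ne_zero hx₀ ((map_ne_zero Θ).2 hx₀)))
  have h₀ : Valued.v (κ₀ + jE V * ξ₀) = Valued.v u₀ := by rw [← hV, hκv]
  -- the digit `κ₀ + jE V₀·ξ₀` is on the same sphere: `|(jE V₀ − jE V)·ξ₀| ≤ r|ξ₀| < R`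
  have hdv : Valued.v ((jE V₀ - jE V) * ξ₀) ≤ r * Valued.v ξ₀ := by
    rw [Valuation.map_mul, Valuation.map_sub_swap]
    exact mul_le_mul' hnear le_rfl
  have hlt : r * Valued.v ξ₀ < Valued.v u₀ := lt_of_mul_lt_mul_right (by rw [hu₀v]; exact hrR) hccpos.le
  have h₁ : Valued.v (κ₀ + jE V₀ * ξ₀) = Valued.v u₀ := by
    have e : κ₀ + jE V₀ * ξ₀ = (κ₀ + jE V * ξ₀) + (jE V₀ - jE V) * ξ₀ := by ring
    have hlt' : Valued.v ((jE V₀ - jE V) * ξ₀) < Valued.v (κ₀ + jE V * ξ₀) := by rw [h₀]; exact hdv.trans_lt hlt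
    rw [e, Valuation.map_add_eq_of_lt_left _ hlt', h₀]
  have hnear' : Valued.v ((jE V₀ - jE V) * ξ₀) ≤ r₀ * Valued.v u₀ := by
    refine hdv.trans (le_of_mul_le_mul_right ?_ hccpos)
    rw [mul_assoc r₀, hu₀v]; exact hr₀
  -- ★ p863710 local constancy: `Q(κ₀ + jE V₀ ξ₀) ∕ Q(κ̂) ∈ 𝒩`
  obtain ⟨c, hρc, hc⟩ := exists_fixed_normTheta_normRho_div_of_near (Θ := Θ) hρρ hvρ hΘρ hξ hΘκ₀ hΘξ (hρj V) (hρj V₀)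
    (by rw [hΘj, hσV]) (by rw [hΘj, hσV₀]) h₀ h₁ hu₀0 hnear' hdeep
  -- compose with §1: `Q(κ̂) ∕ N_ρ(h) ∈ 𝒩`
  have hQ0 : (κ₀ + jE V * ξ₀) * ρ (κ₀ + jE V * ξ₀) ≠ 0 := by
    have h0 : κ₀ + jE V * ξ₀ ≠ 0 := fun h0 => by rw [h0, Valuation.map_zero] at h₀; exact hu₀0 h₀.symm
    exact mul_ne_zero h0 ((map_ne_zero ρ).2 h0)
  have hsplit : (κ₀ + jE V₀ * ξ₀) * ρ (κ₀ + jE V₀ * ξ₀) / (hM * ρ hM) =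
      ((κ₀ + jE V₀ * ξ₀) * ρ (κ₀ + jE V₀ * ξ₀) / ((κ₀ + jE V * ξ₀) * ρ (κ₀ + jE V * ξ₀))) *
        (ρ u₀ / t * ρ (ρ u₀ / t) / (hM * ρ hM)) := by
    rw [hV, div_mul_div_comm, mul_comm ((κ₀ + jE V * ξ₀) * ρ (κ₀ + jE V * ξ₀)) (hM * ρ hM), mul_div_mul_right _ _ hQ0]
  refine ⟨by rw [h₁, hu₀v], ?_⟩
  rw [hsplit]
  exact fixedNorm_mul ⟨c, hρc, hc⟩ ⟨e₂, hρe₂, he₂⟩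

end Summit.HodgeConjecture.HodgeConjecture.Cruxes.H413.F0P3cDyRamRowCellSocketLit

end
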